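import Literature.NumberTheory.EllipticCurves.Sprung2012.ColemanMapTheorems
import HarnessLib

/-!
# Sprung 2012, §7.1 "The image of the Coleman map": Proposition 7.3 (`Col♭` is surjective),
# Proposition 7.6 for the trivial character (`Col♯` is surjective), and Lemma 2.3 (the formal group
# has no `p`-torsion over the local cyclotomic tower) — named facts over `ColemanMaps.lean`

Topic `Literature/NumberTheory/EllipticCurves`, cluster `Sprung2012` (namespace = path). Companion of
`Sprung2012/ColemanMapTheorems.lean` (Thm. 2.2, Props. 3.9/5.7 in the same setting and vocabulary).
THREE published statements of F. E. I. Sprung, *Iwasawa theory for elliptic curves at supersingular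
primes: A pair of main conjectures*, J. Number Theory **132** (2012) 1483–1506 [Sprung2012] (held
text `paper:doi-10-1016-j-jnt-2011-11-003`, read first-hand, pp. 1487, 1500–1501) vendored as NAMED
FACTS (`def … : Prop`, nothing asserted, no `_holds`; D-0014), in the `η = 1` / `ℤ_p`-tower form
and under the transcription convention of `Sprung2012/ColemanMaps.lean` (at a supersingular prime
`H¹_Iw(T) ≅ Hom_ℤ(E(K_∞·K_v), ℤ_p)` by Tate local duality and Lemma 7.10, `(x, z)_n = z(x)`;
`Col(z) = (L♯, L♭)` iff `IsColemanPair … z L♯ L♭`):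

* `prop73_colemanFlat_surjective` — **Proposition 7.3** (p. 1500, verbatim): "`Col♭` is
  surjective." (`Col♭ : H¹_Iw(T) → Λ`, Def. 7.1 "`Col =: (Col♯, Col♭)`"; proof p. 1500: "We can
  prove the surjectivity of `Col♭_0 = −P¹_0` as in [Kobayashi, Proposition 8.23] … Now
  `H¹(k_0, T) → Λ_0` is surjective since its Pontryagin dual is the injection
  `F_ss(𝔪_0) ⊗ ℚ_p/ℤ_p = Ê(k_0) ⊗ ℚ_p/ℤ_p → H¹(k_0, V/T)` … The surjectivity of `Col♭` follows from
  Nakayama's lemma if we know that the corestriction `cor` is surjective"). Read on the `η = 1`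
  component (the surjection `Λ² ⊃ H¹_Iw(k_∞,T) ↠ ℤ_p[Δ]⟦X⟧` restricts to a surjection of
  `Δ`-invariants `H¹_Iw(ℚ_{p,∞}, T) ↠ ℤ_p⟦X⟧`, `p ∤ #Δ`): EVERY `f ∈ Λ = ℤ_p⟦T⟧` is the
  `♭`-component of the Coleman value of some functional `z` on `E(ℚ_∞·ℚ_p)`.
* `prop76_colemanSharp_surjective` — **Proposition 7.6**, first sentence (p. 1501, verbatim): "If
  `η` is trivial, then `ε_η Col♯` is surjective." (proof p. 1501: "The idea is to use the map
  `Col♯_1` in the way we used `Col♭_0` in the proof of Proposition 7.3. For `η` trivial,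
  `(ε_η δ_1^{−1σ})_{σ∈Γ_1}` is a basis for `C_ss^{δ_1^{−1}}(𝔪_1)^η` by the above Corollary 7.8 …").
  EVERY `f ∈ Λ` is the `♯`-component of the Coleman value of some functional. (The second sentence,
  `Im(ε_η Col♯) = J^η` for `η` non-trivial, concerns the other `Δ`-components and is not
  transcribed — TODO(general form).)
* `lem23_localTowerPoints_noPTorsion` — **Lemma 2.3** (p. 1487, verbatim): "`F_ss(k_n)` has no
  `p`-torsion." (`F_ss ≅ Ê` the formal group, `k_n = ℚ_p(ζ_{p^{n+1}}) ⊇ ℚ_{p,n}`; proof: "the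
  nontrivial torsion points live in a totally ramified extension of degree `p² − 1`, which does not
  divide `deg(k_n/ℚ_p)`"), together with the sentence used in the proof of Prop. 7.3 (p. 1500): "the
  cokernel `Ẽ(𝔽_p)` of `Ê(k_0) → E(k_0)` having no `p`-torsion, since `p` is supersingular" (for
  every `n`: `k_n/ℚ_p` is totally ramified, residue field `𝔽_p`, `#Ẽ(𝔽_p) = p + 1 − a_p ≡ 1 (mod p)`).
  Read on points: `E(ℚ_∞·ℚ_p) = ⋃_n E(ℚ_{p,n})` (`localTowerPointsOfEmb`) has NO non-zero
  `p`-torsion point. (= [Sprung2024] "[64, Lemma 2.3]" in the proof of Lemma 5.5, p. 40: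
  "`H⁰(k_n, V/T) = 0`".)

WHY (cell `bsd-ssimc`, seat `bsd-ssimc-k3c5-kdot-split` g6, object «KDOT-L55-KERNEL», route K3
`SignedLowerHalves`, crux `SprungLowerHalfAtThree` = stmt-BirchSwinnertonDyer-19003, split child K2 =
stmt-BirchSwinnertonDyer-19877): these are exactly the inputs that F. Sprung, Adv. Math. 449 (2024)
§5.2, proof of Lemma 5.5 case `v = p` (p. 40), uses silently — "By construction, the right vertical
map [`(H¹_Iw/ker Col⋆_p)_X → H¹(k_0,T)/ker Col⋆_{p,0}`] is an isomorphism" needs `Im Col⋆ = Λ`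
(Props. 7.3/7.6), and "The middle vertical map is a surjection by [64, Lemma 2.3]" — so that the
named facts `Sprung2024.lem55[AllN]_sharpFlat_localKerOver_of_layerToInfty_mem`
(`ChromaticLocalInjectivity.lean`) become kernel theorems modulo the present three
(`Sprung2024/ChromaticLocalInjectivityProofs.lean`). SANITY (recorded for reviewers): only the
INDIVIDUAL surjectivities are printed and used; the joint map `(Col♯, Col♭) : H¹_Iw → Λ²` is NOT
surjective (in the transcription its image mod `T` is the line spanned by
`(a_p(a_p−2)−(p−1), a_p−2)·z(c_{−1})`, by the levels `0, 1` of `IsColemanPair` and Thm. 2.2).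
HONEST FRAMING: three named facts (Honda/formal-group layer of [Sprung2012]; LOCAL statements about
`E/ℚ_p` and the local tower — no conductor hypothesis in print or here), net debt +3; nothing about
any curve is asserted; no census cell moves; BSD is not proved by any of this. TODO(general form):
the full tower `k_n = ℚ_p(ζ_{p^{n+1}})`, all tame characters `η` (`Im(ε_η Col♯) = J^η`), `p = 2`.

Setting of all three (= that of `thm22_exists_isHondaSystem` / `prop39_exists_isColemanPair`, minus
the global generator `γ`, which the statements do not involve): `E = W/ℚ` elliptic, `p ≠ 2` of good
SUPERSINGULAR reduction (`p ∣ a_p`; §7: "From now on, assume `p` is odd", p. 1500), the cyclotomic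
`κ`, `v ∋ p` with the chosen embedding, a local element `g` restricting to a topological generator
of `Gal(ℚ_∞/ℚ)` (`κ.IsTopGenerator (resGalOfEmb _ g)`, the `γ ↦ 1 + T` of the orbit sums), and (for
7.3/7.6) a Honda system `(cneg, c)` (the points `c_n` of Thm. 2.2 through which `Col` is defined).

## References
* [Sprung2012] Lemma 2.3 (p. 1487); Def. 7.1–7.2, Prop. 7.3, Lemmas 7.4–7.5 (p. 1500); Prop. 7.6,
  Lemma 7.7, Cor. 7.8 (p. 1501); Lemma 7.10 (p. 1503).
* [Sprung2024] F. Sprung, Adv. Math. 449 (2024) 109741, §5.2 proof of Lemma 5.5 (p. 40).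
* [Kobayashi2003] S. Kobayashi, Invent. Math. 152 (2003), Prop. 8.23 and (8.23), proof of Prop. 9.2.

## Design
Statements only (three `def … : Prop`), `namespace Literature.NumberTheory.EllipticCurves.Sprung2012`;
binder order = `prop39_exists_isColemanPair`'s without `γ`; no instance, no notation.
-/

noncomputable section

open scoped Classical NumberField

open NumberField IsDedekindDomain WeierstrassCurve Literature.NumberTheory.EllipticCurves
  Literature.NumberTheory.EllipticCurves.ZpExtension Literature.NumberTheory.EllipticCurves.Sprung2017

namespace Literature.NumberTheory.EllipticCurves.Sprung2012

/-- **Sprung 2012, Proposition 7.3** (p. 1500): "`Col♭` is surjective." — on the `η = 1` component and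
under the convention of `ColemanMaps.lean`: for `W/ℚ` elliptic, `p ≠ 2` good supersingular (`p ∣ a_p`),
the cyclotomic `κ`, the place `v ∋ p`, a local lift `g` of a topological generator and a Honda system
`(cneg, c)` (Thm. 2.2), every `f ∈ Λ = ℤ_p⟦T⟧` is `Col♭(z)` for some functional `z` on `E(ℚ_∞·ℚ_p)`
(`= H¹_Iw(T)^{η=1}`): there are `z` and `L♯` with `IsColemanPair … z L♯ f`. Proof in print: surjectivity
of `Col♭_0 = −P¹_0` from the basis `(c_0^σ)` of `F_ss(𝔪_0)` (Lemmas 7.4–7.5) and Tate duality, then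
Nakayama with the surjectivity of corestriction (Lemma 2.3). Nothing is asserted; users take
`(h : prop73_colemanFlat_surjective)`; no `_holds` is expected (Honda theory / the primal structure of
`Ê(𝔪_n)` is not tree vocabulary). [cite: Sprung2012, Prop. 7.3 (p. 1500); Lemmas 7.4–7.5 (p. 1500); Def. 7.1 (p. 1500)]
[cite: Kobayashi2003, Prop. 8.23] -/
def prop73_colemanFlat_surjective : Prop :=
  ∀ (W : WeierstrassCurve ℚ) [W.IsElliptic] [W.IsGloballyMinimal] (p : ℕ) [Fact p.Prime],
    p ≠ 2 → W.HasGoodReductionAtPrime p → (p : ℤ) ∣ W.frobeniusTrace p →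
    ∀ (κ : ZpExtension ℚ p), κ.IsCyclotomic →
    ∀ (v : HeightOneSpectrum (𝓞 ℚ)), (p : 𝓞 ℚ) ∈ v.asIdeal →
    ∀ (g : Field.absoluteGaloisGroup (v.adicCompletion ℚ)),
      κ.IsTopGenerator (resGalOfEmb (closureEmb (K := ℚ) (v.adicCompletion ℚ)) g) →
    ∀ (cneg : localPoints W (v.adicCompletion ℚ)) (c : ℕ → localPoints W (v.adicCompletion ℚ)),
      IsHondaSystem κ (closureEmb (K := ℚ) (v.adicCompletion ℚ)) W (W.frobeniusTrace p) g cneg c →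
    ∀ f : IwasawaAlgebra p,
      ∃ (z : localTowerPointsOfEmb κ (closureEmb (K := ℚ) (v.adicCompletion ℚ)) W →+ ℤ_[p])
        (Lsharp : IwasawaAlgebra p),
        IsColemanPair κ (closureEmb (K := ℚ) (v.adicCompletion ℚ)) W (W.frobeniusTrace p) g c z
          Lsharp f

/-- **Sprung 2012, Proposition 7.6, first sentence** (p. 1501): "If `η` is trivial, then `ε_η Col♯`
is surjective." — the `η = 1` statement itself, under the convention of `ColemanMaps.lean`: in the
setting of `prop73_colemanFlat_surjective`, every `f ∈ Λ` is `Col♯(z)` for some functional `z` on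
`E(ℚ_∞·ℚ_p)`: there are `z` and `L♭` with `IsColemanPair … z f L♭`. Proof in print: "use the map
`Col♯_1` in the way we used `Col♭_0` in the proof of Proposition 7.3. For `η` trivial,
`(ε_η δ_1^{−1σ})_{σ∈Γ_1}` is a basis for `C_ss^{δ_1^{−1}}(𝔪_1)^η` by the above Corollary 7.8". The
second sentence ("If `η` is nontrivial, then `Im(ε_η Col♯) = J^η`") is about the other components —
TODO(general form). Nothing is asserted; no `_holds` is expected.
[cite: Sprung2012, Prop. 7.6 first sentence (p. 1501); Lemma 7.7 and Cor. 7.8 (p. 1501)] -/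
def prop76_colemanSharp_surjective : Prop :=
  ∀ (W : WeierstrassCurve ℚ) [W.IsElliptic] [W.IsGloballyMinimal] (p : ℕ) [Fact p.Prime],
    p ≠ 2 → W.HasGoodReductionAtPrime p → (p : ℤ) ∣ W.frobeniusTrace p →
    ∀ (κ : ZpExtension ℚ p), κ.IsCyclotomic →
    ∀ (v : HeightOneSpectrum (𝓞 ℚ)), (p : 𝓞 ℚ) ∈ v.asIdeal →
    ∀ (g : Field.absoluteGaloisGroup (v.adicCompletion ℚ)),
      κ.IsTopGenerator (resGalOfEmb (closureEmb (K := ℚ) (v.adicCompletion ℚ)) g) →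
    ∀ (cneg : localPoints W (v.adicCompletion ℚ)) (c : ℕ → localPoints W (v.adicCompletion ℚ)),
      IsHondaSystem κ (closureEmb (K := ℚ) (v.adicCompletion ℚ)) W (W.frobeniusTrace p) g cneg c →
    ∀ f : IwasawaAlgebra p,
      ∃ (z : localTowerPointsOfEmb κ (closureEmb (K := ℚ) (v.adicCompletion ℚ)) W →+ ℤ_[p])
        (Lflat : IwasawaAlgebra p),
        IsColemanPair κ (closureEmb (K := ℚ) (v.adicCompletion ℚ)) W (W.frobeniusTrace p) g c z
          f Lflat

/-- **Sprung 2012, Lemma 2.3** (p. 1487): "`F_ss(k_n)` has no `p`-torsion." — with the supersingular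
remark of the proof of Prop. 7.3 (p. 1500: "the cokernel `Ẽ(𝔽_p)` of `Ê(k_0) → E(k_0)` having no
`p`-torsion, since `p` is supersingular"; `k_n/ℚ_p` totally ramified, `#Ẽ(𝔽_p) = p + 1 − a_p ≡ 1
(mod p)`), read on points over the local cyclotomic `ℤ_p`-tower `ℚ_{p,n} ⊆ k_n = ℚ_p(ζ_{p^{n+1}})`:
for `W/ℚ` elliptic, `p ≠ 2` of good supersingular reduction (`p ∣ a_p`), the cyclotomic `κ` and the
place `v ∋ p`, the group `E(ℚ_∞·ℚ_p) = ⋃_n E(ℚ_{p,n})` (`localTowerPointsOfEmb`) has no non-zero point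
killed by `p`. (= "[64, Lemma 2.3]" as used in [Sprung2024] §5.2, proof of Lemma 5.5, p. 40:
"`H⁰(k_n, V/T) = 0`".) Nothing is asserted; no `_holds` is expected here (a kernel proof would go
through the inertia action on `E[p]` at a supersingular prime, Serre 1972 §1.11, and the torsion
transport `exists_pointsMapOfEmb_eq_of_nsmul_eq_zero`).
[cite: Sprung2012, Lemma 2.3 (p. 1487); proof of Prop. 7.3 (p. 1500)]
[cite: Sprung2024, §5.2 proof of Lemma 5.5 (p. 40) ("[64, Lemma 2.3]")] -/
def lem23_localTowerPoints_noPTorsion : Prop :=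
  ∀ (W : WeierstrassCurve ℚ) [W.IsElliptic] [W.IsGloballyMinimal] (p : ℕ) [Fact p.Prime],
    p ≠ 2 → W.HasGoodReductionAtPrime p → (p : ℤ) ∣ W.frobeniusTrace p →
    ∀ (κ : ZpExtension ℚ p), κ.IsCyclotomic →
    ∀ (v : HeightOneSpectrum (𝓞 ℚ)), (p : 𝓞 ℚ) ∈ v.asIdeal →
    ∀ P : localPoints W (v.adicCompletion ℚ),
      P ∈ localTowerPointsOfEmb κ (closureEmb (K := ℚ) (v.adicCompletion ℚ)) W → p • P = 0 → P = 0

end Literature.NumberTheory.EllipticCurves.Sprung2012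

end
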